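import Literature.MathematicalPhysics.QuantumFieldTheory.Balaban1983to89.T4SeparableFibreExpansion
import Literature.MathematicalPhysics.QuantumFieldTheory.Balaban1983to89.T4AvgDiagBound

/-!
# `Balaban1983to89.T4AdaptedReference` — the EXTERIOR-ADAPTED reference centre of the (CM) channel's separable fibre
# expansion: the weight chart centred at a configuration-dependent fibre point `c(V)` constant along each fibre, the
# law side read AT THE SAME EXTERIOR (odd part ∕ diagonal ∕ centre offset), and the end-to-end `CondMeanGap` for
# products of loop variables of iterated averages with each law symmetric about its own centre — down to window data
# (cell T4, node O3b ∕ NE1′ telescope; bookkeeping seam; row `T4-O3.E-NE1′-TEL-ADREF*`, lineage pv16 generation 14)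

HONEST FRAMING.  Audit cell `pub-balaban`, unit `b2b-balaban-pv16-g14` (SURGE NODE PROVER #16; lineage continuation of
`T4SeparableFibreExpansion` v1.3, companion record `HOME/t4/T4-EST-O3Ei1.md` §4k).  The cell's T4 target is the
existence and uniqueness of the continuum limit of unit-scale averaged loop expectations on a FINITE torus, with
Bałaban's densities as GIVEN data satisfying the printed end statement (B) as a HYPOTHESIS; it is NOT an
infinite-volume statement, NOT a mass gap, NOT the Clay problem, and this module is NOT progress on any summit.
Value = kernel-checked bookkeeping and nothing more.  What it settles is a TYPING question left open by
`T4SeparableFibreExpansion` §4–§5 (record items (L-b) «the exterior total-variation term of a FIXED reference point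
`(V₀, y₀)`» and (L-c) «uniform-in-`V` flatness of the increment reading's conditional means»): both are artefacts of
reading the weight chart at ONE reference point for ALL exteriors.  Here the chart is centred, on the fibre through
`V`, at a point `c V` of the fibre that depends on the EXTERIOR of `V` only (`CentreIndep s c`: `c (V ← y) = c V`; e.g.
the restriction to the fibre of a fibre-independent background field, `T4FibreTranslate.FieldIndep`, the shape of the
tree's `vΛ` ∕ `V_Λ`), and the law side is read at the configuration's OWN exterior `u` — law and reading share the
exterior, so no exterior variation and no flatness uniform in the exterior is ever asked.  What remains on the law
side is typed as THREE functionals of the exterior: `α` (the mean of the ODD part of the one-bond increment about a law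
centre `c′ u` — zero when the conditional law at `u` is reflection-symmetric about `c′ u`, by
`T4SeparableFibreExpansion.integral_oddIncr_eq_zero` ∕ `map_bondReflect_condLaw` BY NAME), `κ` (the mean of the EVEN
part = half a one-bond symmetric second difference of the weight — second order: for loop products it is discharged
from t4-lean's HYPOTHESIS SHAPE `T4AvgDiagBound.LoopDiagDerivBound` BY NAME, times the law's one-bond second moment
about the centre, itself at most the squared window radius), and `ω` (the CENTRE OFFSET `g(u ← (c u; b ← c′ u b)) −
g(u ← c u)`: first order in the distance between the chart centre and the law centre, zero when they coincide).  For
the channel with TWO laws (old ∕ insert) one chart centre serves both; taking it to be the old law's centre `c₁`, the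
insert law contributes `ω₂ ≤` (one-bond increment rate of the weight) × (THE INSERT'S CENTRE SHIFT `bdist (c₁ u b)
(c₂ u b)`) — the channel's only first-order term, made explicit and left as a binder `δ`: its size and decay for
Bałaban's terms is NOT claimed (record item (L-h)); which of the printed conditional laws are reflection-symmetric
about which centre on which fibres is NOT claimed either (record item (L-f′); §1 proves only the kernel fact that a
RELATIVE WINDOW with inversion-symmetric one-bond profile is symmetric about the background centre,
`relWindow_bondReflect`, with the non-vacuity witness `inversionSymm_of_radial`).

CITATION HEADER.  Nothing of T. Bałaban's series (CMP 1984–89) is newly read, quoted or attributed in this module.  The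
only contact with print is CONTEXT, through tree headers quoted EARLIER and not re-quoted here: the structure «window in
the relative one-bond variable about a configuration-dependent background» is that of the printed small-field
characteristic functions cited in `T4CondLawRelative.relWindow` ([Balaban1989LargeFieldI] (1.101) p. 201;
[Balaban1987RG1] (2.9) p. 266) and of `T4FibreTranslate.FieldIndep` (p. 197); the term structure (`TermProvisos`,
`liveSet`, `CondMeanGap`, `CondMeanSuppression`, `condMeanField`, `condLaw`) is the cell's typed model of one term of
[Balaban1989LargeFieldI] (0.3) as documented in `T4ObservableTelescope` ∕ `T4CondMeanChannel`, and the averaging side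
enters only through the HYPOTHESIS SHAPES `LoopDerivBound` ∕ `LoopPairDerivBound` ∕ `FibreConvex` of `T4AvgDerivBound`
and `LoopDiagDerivBound` of `T4AvgDiagBound` (the latter a cell typing of a located, NOT PRINTED one-bond second-order
rate — its own header says so; consumed here only as a hypothesis) — all BY NAME.  ABSOLUTE RULE honoured: no
programme-internal statement is an input; every declaration below is [folklore] bookkeeping (finite sums, `abs`,
Bochner-integral linearity and monotonicity, support transfer `T4DressingDefect.ae_condLaw_of_support`, change of
variables along a measurable self-equivalence already in the tree, induction on lists).

NEW vs PRINTED-TYPE.  PRINTED-TYPE: none newly used.  CELL MODEL typed EARLIER (by name): the (CM) channel and its chart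
format (`T4CondMeanChannelInsert.condMeanGap_of_suppression`), the separable expansion, the one-bond increments
`bondIncr`, the odd ∕ even split and the bond reflection (`T4SeparableFibreExpansion` §2–§6), the diagonal bound for
loop products (`T4AvgDiagBound.abs_evenIncr_loopProdW_le`, `loopProdDiagRate`), the relative window and `onFibre`
(`T4CondLawRelative`), `FieldIndep` (`T4FibreTranslate`).  NEW HERE (kernel, [folklore]): the adapted centre and reading
(§1), the law side at the same exterior (§2), the loop-product instances and the end-to-end corollaries (§3).

WHAT IS PROVED (all [folklore]; no `sorry`, no new axiom):
§1 `CentreIndep s c` (+ `.const`, `centreIndep_onFibre` from `FieldIndep`), the ADAPTED INCREMENT READING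
   `incrReadingAd s g c U b = g(U ← (c U; b ← U_b)) − g(U ← c U)` (`incrReadingAd_const`: a constant centre gives
   `T4SeparableFibreExpansion.incrReadingLoc`; `incrReadingAd_updateFinset`: on the fibre through `V` it reads
   `bondIncr s g V (c V) y b`; `measurable_incrReadingAd`), the chart identity `chartAd_eq_fibreSepRem` (remainder =
   `fibreSepRem s g V (c V) V y`), the junctions `condMeanGap_of_separableAd` (any bounded measurable weight; =
   `condMeanGap_of_suppression` with `m V = g(V ← c V)`, `Φ = incrReadingAd`) and `condMeanGap_of_loopProdAd` (weight
   `loopProdW`; cover = both `V ← c V` and `V ← y` in `dom j` and `(Σ_b bdist (c V b) (y b))² ≤ Δᵢ` on the live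
   configurations — the squared WINDOW RADIUS about the moving centre, no exterior term); `bondReflect_update`,
   `relWindow_bondReflect` (a relative window `relWindow s vΛ w` whose profile is invariant under inversion of the `b`-th
   relative variable is invariant under the bond reflection through the background centre `(vΛ u)⌈_s` on the fibre
   through `u`, for `FieldIndep s vΛ`) and `inversionSymm_of_radial` (a profile radial in the `b`-th variable is
   inversion-symmetric in it: the hypothesis is inhabited).
§2 `condMeanField_incrReadingAd` (`= ∫ bondIncr s g u (c u) y b ∂condLaw s w u`: law and reading at the SAME exterior),
   `bondIncr_recenter` (`bondIncr(c u) y = bondIncr(c u; b ← c′ u b) y + bondIncr(c u)(c′ u)`),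
   `abs_condMeanField_incrReadingAd_le` (`≤ |∫ odd| + |∫ even| + |offset|` about ANY law centre; the conditional law is
   zero or a probability measure), `condMeanSuppression_incrReadingAd_of_split` (`CondMeanSuppression dom
   (condMeanField s w (incrReadingAd s g c)) univ (α + κ + ω) 1` from the three binder functionals),
   `integral_oddIncr_recenter_eq_zero` ∕ `condMeanSuppression_incrReadingAd_of_lawSymm` ∕ `…_of_weightSymm` (`α = 0`
   under reflection symmetry of `condLaw s w u` about `c′ u`, resp. of the weight on the fibre through `u`),
   `condMeanSuppression_incrReadingAd_of_lawSymm_self` (law centre = chart centre: datum `κ` alone),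
   `abs_integral_evenIncr_le` ∕ `abs_integral_evenIncr_le_of_secondDiff` (`κ` from an a.e. majorant ∕ from the
   one-bond second-difference shape `hdiag` at `(u, y₀)` on the law's SUPPORT), `measurable_bdist_apply`,
   `secondMoment_le_of_window` (weight supported within one-bond radius `ε` of `y₀ b` over `u` ⇒ the conditional law's
   second moment about `y₀ b` is `≤ ε²`, integrability included), `exists_ne_zero_of_mem_liveSet` (a live exterior
   carries a support point), `bdist_triangle`.
§3 `loopIncrRate` (`Σᵢ C₁|wᵢ|θ₁ⁿ`; `_nonneg`, `_cons`), `abs_bondIncr_loopProdW_le` (`|bondIncr| ≤ loopIncrRate ·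
   bdist(y₀ b, y b)` from `LoopDerivBound` alone, both configurations in `dom`; discrete Leibniz rule along the list),
   `abs_centreOffset_loopProdW_le` (the offset `ω ≤ loopIncrRate · bdist (c u b) (c′ u b)`),
   `abs_integral_evenIncr_loopProdW_le` (the diagonal `κ ≤ (loopProdDiagRate/2)·M` about ANY centre from
   `LoopDiagDerivBound` BY NAME, the three reflection-triple points in `dom j` only on the law's support), and three
   END-TO-END corollaries for one dressed term (`TermProvisos`), the averaging shapes on a fibre-convex domain and a chart
   centre `c₁` constant along fibres and measurable: `condMeanGap_of_loopProdAd_symm` (old law symmetric about `c₁ u`,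
   insert law symmetric about `c₂ u`, diagonal functionals `κ₁, κ₂` and offset functional `ω₂` as binders, capped on the
   live set ⇒ `CondMeanGap … ((|s|·d₁ + rate·Δ₁) + (|s|·d₂ + rate·Δ₂))`), `condMeanGap_of_loopProdAd_moments` (`κᵢ`
   discharged: law side = symmetry + window sections in `dom j` + one-bond second moments `Mᵢ` about the own centre +
   centre shift `δ`; conclusion `((|s|·(r₃/2)·m₁ + rate·Δ₁) + (|s|·((r₃/2)·m₂ + r₁·δ₀) + rate·Δ₂))`), and
   `condMeanGap_of_loopProdAd_windows` (everything in WINDOW DATA: old weight supported in the one-bond `ε₁`-box about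
   `c₁ V` on every fibre, insert in the `ε₂`-box about `c₂ V`, centre shift `≤ δ₀` on the live set, the `ε₁`-box ∕
   `(δ₀+ε₂)`-box about `c₁ V` inside `dom j` where relevant, both laws symmetric about their own centres at the live
   exteriors ⇒ `CondMeanGap s ins old (loopProdW …) ((|s|·(r₃/2)·ε₁² + rate·(|s|ε₁)²) + (|s|·((r₃/2)·ε₂² + r₁·δ₀) +
   rate·(|s|(δ₀+ε₂))²))` with `r₃ = loopProdDiagRate C₁ θ₁ C₃ θ₃ n ws`, `r₁ = loopIncrRate C₁ θ₁ n ws`, `rate =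
   loopProdRate C₁ θ₁ C₂ θ₂ n ws`) — SECOND ORDER in the window radii except for the single first-order term
   `|s|·r₁·δ₀`, the insert's centre shift.

HONEST SCOPE.  (i) Nothing here says which of Bałaban's conditional laws is symmetric about which centre: symmetry is a
per-exterior BINDER (`hsym` ∕ `hwsym`); §1's `relWindow_bondReflect` covers the WINDOW factor of a relative-window law
only, not the action factor, and multi-bond fibres whose bonds share a plaquette are exactly where an action factor's
one-bond symmetry centre depends on the other fibre variables (record (L-f′)).  (ii) The centre shift `bdist (c₁ u b)
(c₂ u b)` between the old law's and the insert's centres is a binder (`δ`, `δ₀`); its size ∕ decay in the distance to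
the insert (a background-field response) is the genuinely first-order content of the channel and is NOT estimated here
(record (L-h)).  (iii) `κ` is second order only through `LoopDiagDerivBound`, whose ORIGIN for Bałaban's averaging
operations is a located, not printed item of `T4AvgDiagBound`'s own header (their (L-a)); here it is a hypothesis.
(iv) The factor `|s|` (full fibre size) and `|s|²` in the cover are carried as typed; whether a count absorbs them is
the consumer's (ii′)/(ii″) of `T4SeparableFibreExpansion`, untouched.  (v) The box conditions `hbox₁` ∕ `hbox₂` ask the
averaging-regularity domain `dom j` to contain one-bond boxes about the centre over exteriors whose fibre meets the
support — a statement about the cell's HYPOTHESIS SHAPES, not about any printed domain.  (vi) No quantitative claim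
about Bałaban's densities, windows, averagings or constants is made anywhere in this file.
-/

open _root_.MeasureTheory
open Function (updateFinset)
open scoped BigOperators InnerProductSpace ENNReal

namespace Literature.MathematicalPhysics.QuantumFieldTheory.Balaban1983to89.T4AdaptedReference

open Literature.MathematicalPhysics.QuantumFieldTheory.Balaban1983to89
open B15.BasicStep T4DressedR T4DressingDefect T4FirstOrderSize T4CondLawRelative T4ObservableTelescope
open T4CondMeanChannel T4CondMeanChannelInsert T4CovarianceResponse T4Continuum T4AvgSensitivity T4AvgDerivBound
open T4FibreTranslate T4SeparableFibreExpansion T4AvgDiagBound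

/-! ## §1  The adapted centre, the adapted increment reading, the chart identity and the junctions -/

section Centre

variable {P : Params} {j : ℕ} {G : Type*} [GaugeGroup G] [MeasurableSpace G] [HaarData G]
variable [DecidableEq (PBond P j)]

omit [GaugeGroup G] [MeasurableSpace G] [HaarData G] in
/-- HYPOTHESIS SHAPE — A CHART CENTRE CONSTANT ALONG THE FIBRES: `c : GaugeField → (s → G)` depends on the configuration
only through its exterior, `c (V ← y) = c V`.  (The fibre restriction of a fibre-independent background field has it:
`centreIndep_onFibre`.) [folklore] -/
def CentreIndep (s : Finset (PBond P j)) (c : GaugeField P j G → s → G) : Prop :=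
  ∀ (V : GaugeField P j G) (y : s → G), c (updateFinset V s y) = c V

omit [GaugeGroup G] [MeasurableSpace G] [HaarData G] in
/-- A constant centre is fibre-constant. [folklore] -/
theorem CentreIndep.const (s : Finset (PBond P j)) (y₀ : s → G) : CentreIndep s (fun _ : GaugeField P j G => y₀) :=
  fun _ _ => rfl

omit [GaugeGroup G] [MeasurableSpace G] [HaarData G] in
/-- THE BACKGROUND CENTRE: the fibre restriction `V ↦ (vΛ V)⌈_s` of a fibre-independent field functional
(`T4FibreTranslate.FieldIndep s vΛ`, the hypothesis shape of the tree's `V_Λ`) is a fibre-constant centre. [folklore] -/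
theorem centreIndep_onFibre (s : Finset (PBond P j)) {vΛ : GaugeField P j G → GaugeField P j G}
    (hv : FieldIndep s vΛ) : CentreIndep s (fun V => onFibre s (vΛ V)) :=
  fun V y => congrArg (onFibre s) (hv V y)

omit [GaugeGroup G] [MeasurableSpace G] [HaarData G] in
/-- THE ADAPTED INCREMENT READING `U ↦ (b ↦ g(U ← (c U; b ← U_b)) − g(U ← c U))`: the one-bond increments of the
weight at the configuration's OWN exterior, about the ADAPTED centre `c U` (exterior-dependent reading; compare
`T4SeparableFibreExpansion.incrReadingLoc`, the constant-centre case). [folklore] -/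
def incrReadingAd (s : Finset (PBond P j)) (g : Density P j G) (c : GaugeField P j G → s → G) :
    GaugeField P j G → s → ℝ :=
  fun U b => g (updateFinset U s (Function.update (c U) b (U b))) - g (updateFinset U s (c U))

omit [GaugeGroup G] [MeasurableSpace G] [HaarData G] in
/-- A constant centre gives the local increment reading of `T4SeparableFibreExpansion` §4. [folklore] -/
theorem incrReadingAd_const (s : Finset (PBond P j)) (g : Density P j G) (y₀ : s → G) :
    incrReadingAd s g (fun _ => y₀) = incrReadingLoc s g y₀ := rfl

omit [GaugeGroup G] [MeasurableSpace G] [HaarData G] in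
/-- On the fibre through `V`: `incrReadingAd (V ← y) b = bondIncr s g V (c V) y b` (reference point `(V, c V)`).
[folklore] -/
theorem incrReadingAd_updateFinset (s : Finset (PBond P j)) (g : Density P j G) {c : GaugeField P j G → s → G}
    (hc : CentreIndep s c) (V : GaugeField P j G) (y : s → G) (b : s) :
    incrReadingAd s g c (updateFinset V s y) b = bondIncr s g V (c V) y b := by
  have hb : updateFinset V s y (b : PBond P j) = y b := by simp [Function.updateFinset, b.2]
  simp only [incrReadingAd, bondIncr, hc V y, hb, Function.updateFinset_updateFinset_of_subset (subset_refl s)]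

omit [GaugeGroup G] [MeasurableSpace G] [HaarData G] in
/-- The (CM) channel's weight chart with unit amplitudes, the ADAPTED increment reading and the reference
`m V = g(V ← c V)` IS the separable expansion with reference point `(V, c V)`:
`g(V←y) − g(V←c V) − linDensity 1 univ 1 (incrReadingAd) (V←y) = fibreSepRem s g V (c V) V y`. [folklore] -/
theorem chartAd_eq_fibreSepRem (s : Finset (PBond P j)) (g : Density P j G) {c : GaugeField P j G → s → G}
    (hc : CentreIndep s c) (V : GaugeField P j G) (y : s → G) :
    g (updateFinset V s y) - g (updateFinset V s (c V))
        - linDensity 1 Finset.univ (fun _ : s => (1 : ℝ)) (incrReadingAd s g c) (updateFinset V s y)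
      = fibreSepRem s g V (c V) V y := by
  simp only [fibreSepRem, linDensity_apply, linTerm, incrReadingAd_updateFinset s g hc, one_mul,
    RCLike.inner_apply, map_one, mul_one]

omit [GaugeGroup G] [HaarData G] in
/-- Measurability of the adapted reading in the configuration, for a measurable weight and a measurable centre.
[folklore] -/
theorem measurable_incrReadingAd (s : Finset (PBond P j)) {g : Density P j G} (hg : Measurable g)
    {c : GaugeField P j G → s → G} (hcm : Measurable c) (b : s) :
    Measurable fun U : GaugeField P j G => incrReadingAd s g c U b := by
  have h1 : Measurable fun U : GaugeField P j G => Function.update (c U) b (U (b : PBond P j)) :=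
    (measurable_update' (a := b)).comp (hcm.prodMk (measurable_pi_apply (b : PBond P j)))
  have h2 : Measurable fun U : GaugeField P j G => updateFinset U s (Function.update (c U) b (U (b : PBond P j))) :=
    (measurable_updateFinset' (s := s)).comp (measurable_id.prodMk h1)
  have h3 : Measurable fun U : GaugeField P j G => updateFinset U s (c U) :=
    (measurable_updateFinset' (s := s)).comp (measurable_id.prodMk hcm)
  exact (hg.comp h2).sub (hg.comp h3)

/-- **THE JUNCTION WITH ADAPTED CENTRE.**  As `T4SeparableFibreExpansion.condMeanGap_of_separableLoc`, with the chart
centred at `c V` on the fibre through `V` (`CentreIndep s c`, `c` measurable): `Φ = incrReadingAd s g c` (the LAW SIDE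
must suppress the conditional means of this exterior-dependent reading — §2 reads them at the SAME exterior), reference
`m V = g(V ← c V)` (fibre-independent by `CentreIndep`), remainders `|fibreSepRem s g V (c V) V y| ≤ qᵢ` on the live
configurations. [folklore] -/
theorem condMeanGap_of_separableAd {s : Finset (PBond P j)} {ins old : Density P j G} {C : ℝ}
    (hP : TermProvisos s ins old C) {g : Density P j G} (hg : Measurable g) {Bg : ℝ} (hBg : ∀ U, |g U| ≤ Bg)
    {c : GaugeField P j G → s → G} (hc : CentreIndep s c) (hcm : Measurable c)
    {dom₁ dom₂ : Set (GaugeField P j G)} {dev₁ dev₂ : GaugeField P j G → ℝ} {lip₁ lip₂ d₁ d₂ q₁ q₂ : ℝ}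
    (hsup₁ : CondMeanSuppression dom₁ (condMeanField s old (incrReadingAd s g c)) Finset.univ dev₁ lip₁)
    (hsup₂ : CondMeanSuppression dom₂ (condMeanField s ins (incrReadingAd s g c)) Finset.univ dev₂ lip₂)
    (hdom₁ : liveSet s old ⊆ dom₁) (hdom₂ : liveSet s old ⊆ dom₂) (hdev₁ : ∀ V ∈ liveSet s old, dev₁ V ≤ d₁)
    (hdev₂ : ∀ V ∈ liveSet s old, dev₂ V ≤ d₂) (hlip₁ : 0 ≤ lip₁) (hlip₂ : 0 ≤ lip₂)
    (hq₁ : ∀ (V : GaugeField P j G) (y : s → G), old (updateFinset V s y) ≠ 0 →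
      |fibreSepRem s g V (c V) V y| ≤ q₁)
    (hq₂ : ∀ V ∈ liveSet s old, ∀ y : s → G, ins (updateFinset V s y) ≠ 0 → |fibreSepRem s g V (c V) V y| ≤ q₂) :
    CondMeanGap s ins old g
      (((s.card : ℝ) * (lip₁ * d₁) + q₁) + ((s.card : ℝ) * (lip₂ * d₂) + q₂)) := by
  have hmI : FibreIndep s (fun V => g (updateFinset V s (c V))) := fun x y => by
    simp only [hc x y, Function.updateFinset_updateFinset_of_subset (subset_refl s)]
  have hmm : Measurable fun V : GaugeField P j G => g (updateFinset V s (c V)) :=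
    hg.comp ((measurable_updateFinset' (s := s)).comp (measurable_id.prodMk hcm))
  have hBm : ∀ U : GaugeField P j G, |g (updateFinset U s (c U))| ≤ Bg := fun U => hBg _
  have hA : ∀ b ∈ (Finset.univ : Finset s), ‖(fun _ : s => (1 : ℝ)) b‖ ≤ 1 := fun b _ => by simp
  have hΦ : ∀ b ∈ (Finset.univ : Finset s), StronglyMeasurable fun U => incrReadingAd s g c U b :=
    fun b _ => (measurable_incrReadingAd s hg hcm b).stronglyMeasurable
  have hR : ∀ b ∈ (Finset.univ : Finset s), ∀ U, ‖incrReadingAd s g c U b‖ ≤ Bg + Bg := by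
    intro b _ U
    rw [Real.norm_eq_abs]
    exact (abs_sub _ _).trans (add_le_add (hBg _) (hBg _))
  have h := condMeanGap_of_suppression hP hg hBg hmm hBm hmI 1 hA hΦ hR hsup₁ hsup₂ hdom₁ hdom₂ hdev₁ hdev₂
    hlip₁ hlip₂ (fun V y hy => by rw [chartAd_eq_fibreSepRem s g hc]; exact hq₁ V y hy)
    (fun V hV y hy => by rw [chartAd_eq_fibreSepRem s g hc]; exact hq₂ V hV y hy)
  simpa only [abs_one, one_mul, mul_one, Finset.card_univ, Fintype.card_coe] using h

/-- **THE (CM) CHANNEL FOR `loopProdW` WITH ADAPTED CENTRE — COMPLETE HYPOTHESIS LIST.**  As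
`T4SeparableFibreExpansion.condMeanGap_of_loopProdLoc` but with the chart centred at `c V`: LAW SIDE = suppression data
for `incrReadingAd s (loopProdW …) c`; COVER ∕ WINDOW = both `V ← c V` and `V ← y` in `dom j` and
`(Σ_b bdist (c V b) (y b))² ≤ Δᵢ` on the live configurations — the squared window radius about the MOVING centre, NO
exterior variation.  Conclusion `CondMeanGap … ((|s|·lip₁·d₁ + rate·Δ₁) + (|s|·lip₂·d₂ + rate·Δ₂))`. [folklore] -/
theorem condMeanGap_of_loopProdAd [RegularGaugeGroup G] {s : Finset (PBond P j)} {ins old : Density P j G}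
    {C : ℝ} (hP : TermProvisos s ins old C) {av : ∀ i, Averaging P i G} (hav : ∀ i, Measurable (av i).avg)
    {dom : ∀ i, Set (GaugeField P i G)} {C₁ θ₁ C₂ θ₂ : ℝ} (hder : LoopDerivBound av dom C₁ θ₁)
    (hpair : LoopPairDerivBound av dom C₂ θ₂) (hconv : FibreConvex dom) (hC₁ : 0 ≤ C₁) (hθ₁ : 0 ≤ θ₁)
    (hC₂ : 0 ≤ C₂) (hθ₂ : 0 ≤ θ₂) {n : ℕ} (hn : j + n ≤ P.m + P.K)
    (ws : List (Site P (j + n) × List (Letter P.d))) (hws : ∀ xw ∈ ws, walkEnd xw.1 xw.2 = xw.1)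
    {c : GaugeField P j G → s → G} (hc : CentreIndep s c) (hcm : Measurable c)
    {dom₁ dom₂ : Set (GaugeField P j G)} {dev₁ dev₂ : GaugeField P j G → ℝ} {lip₁ lip₂ d₁ d₂ Δ₁ Δ₂ : ℝ}
    (hsup₁ : CondMeanSuppression dom₁ (condMeanField s old (incrReadingAd s (loopProdW av j n ws) c))
      Finset.univ dev₁ lip₁)
    (hsup₂ : CondMeanSuppression dom₂ (condMeanField s ins (incrReadingAd s (loopProdW av j n ws) c))
      Finset.univ dev₂ lip₂)
    (hdom₁ : liveSet s old ⊆ dom₁) (hdom₂ : liveSet s old ⊆ dom₂) (hdev₁ : ∀ V ∈ liveSet s old, dev₁ V ≤ d₁)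
    (hdev₂ : ∀ V ∈ liveSet s old, dev₂ V ≤ d₂) (hlip₁ : 0 ≤ lip₁) (hlip₂ : 0 ≤ lip₂)
    (hcov₁ : ∀ (V : GaugeField P j G) (y : s → G), old (updateFinset V s y) ≠ 0 →
      updateFinset V s (c V) ∈ dom j ∧ updateFinset V s y ∈ dom j ∧ (∑ b : s, bdist (c V b) (y b)) ^ 2 ≤ Δ₁)
    (hcov₂ : ∀ V ∈ liveSet s old, ∀ y : s → G, ins (updateFinset V s y) ≠ 0 →
      updateFinset V s (c V) ∈ dom j ∧ updateFinset V s y ∈ dom j ∧ (∑ b : s, bdist (c V b) (y b)) ^ 2 ≤ Δ₂) :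
    CondMeanGap s ins old (loopProdW av j n ws)
      (((s.card : ℝ) * (lip₁ * d₁) + loopProdRate C₁ θ₁ C₂ θ₂ n ws * Δ₁)
        + ((s.card : ℝ) * (lip₂ * d₂) + loopProdRate C₁ θ₁ C₂ θ₂ n ws * Δ₂)) := by
  have hrate := loopProdRate_nonneg (C₁ := C₁) (θ₁ := θ₁) hC₂ hθ₂ n ws
  refine condMeanGap_of_separableAd hP (measurable_loopProdW av hav j n ws) (abs_loopProdW_le_one av j n ws) hc hcm
    hsup₁ hsup₂ hdom₁ hdom₂ hdev₁ hdev₂ hlip₁ hlip₂ (fun V y hV => ?_) (fun V hV y hy => ?_)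
  · obtain ⟨h₀, h₁, hΔ⟩ := hcov₁ V y hV
    exact (abs_fibreSepRem_loopProdW_loc_le hder hpair hconv hC₁ hθ₁ hC₂ hθ₂ hn ws hws s h₀ h₁).trans
      (mul_le_mul_of_nonneg_left hΔ hrate)
  · obtain ⟨h₀, h₁, hΔ⟩ := hcov₂ V hV y hy
    exact (abs_fibreSepRem_loopProdW_loc_le hder hpair hconv hC₁ hθ₁ hC₂ hθ₂ hn ws hws s h₀ h₁).trans
      (mul_le_mul_of_nonneg_left hΔ hrate)

omit [MeasurableSpace G] [HaarData G] in
/-- The bond reflection through `y₀` at `b` depends on `y₀` only through `y₀ b`: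
`bondReflect (y₀; b ← y₁ b) b = bondReflect y₁ b`. [folklore] -/
theorem bondReflect_update {s : Finset (PBond P j)} (y₀ y₁ : s → G) (b : s) :
    bondReflect (Function.update y₀ b (y₁ b)) b = bondReflect y₁ b := by
  funext y
  simp only [bondReflect, Function.update_self]

omit [MeasurableSpace G] [HaarData G] in
/-- **A RELATIVE WINDOW WITH INVERSION-SYMMETRIC ONE-BOND PROFILE IS REFLECTION-SYMMETRIC ABOUT THE BACKGROUND CENTRE.**
For `FieldIndep s vΛ` and a window profile `w` invariant under inversion of the `b`-th relative variable
(`w (y′; b ← (y′ b)⁻¹) = w y′`), the relative window `T4CondLawRelative.relWindow s vΛ w` is invariant, on the fibre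
through `u`, under the bond reflection through the background centre `(vΛ u)⌈_s` at `b` — the weight-symmetry binder
`hwsym` of §2 for the WINDOW factor of a relative-window law (the action factor is NOT covered; nothing about the printed
windows is asserted). [folklore] -/
theorem relWindow_bondReflect (s : Finset (PBond P j)) {vΛ : GaugeField P j G → GaugeField P j G}
    (hv : FieldIndep s vΛ) {w : (s → G) → ℝ} (b : s)
    (hw : ∀ y' : s → G, w (Function.update y' b (y' b)⁻¹) = w y') (u : GaugeField P j G) (y : s → G) :
    relWindow s vΛ w (updateFinset u s (bondReflect (onFibre s (vΛ u)) b y))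
      = relWindow s vΛ w (updateFinset u s y) := by
  rw [relWindow_updateFinset s hv, relWindow_updateFinset s hv,
    ← hw (fun b' : s => y b' * (vΛ u b')⁻¹)]
  congr 1
  funext b'
  by_cases hb' : b' = b
  · subst hb'
    simp only [bondReflect_apply_self, onFibre_apply, Function.update_self, mul_inv_rev, inv_inv,
      mul_inv_cancel_right]
  · simp only [bondReflect_apply_ne _ _ _ hb', Function.update_of_ne hb']

omit [MeasurableSpace G] [HaarData G] in
/-- NON-VACUITY of `relWindow_bondReflect`'s profile hypothesis: a profile that depends on the `b`-th relative variable
only through its distance to the identity (the other variables held) is inversion-symmetric in it (`dist1` is inversion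
invariant). [folklore] -/
theorem inversionSymm_of_radial {s : Finset (PBond P j)} (b : s) (F : (s → G) → ℝ → ℝ) {w : (s → G) → ℝ}
    (hF : ∀ y' : s → G, w y' = F (Function.update y' b 1) (bdist 1 (y' b))) (y' : s → G) :
    w (Function.update y' b (y' b)⁻¹) = w y' := by
  rw [hF, hF, Function.update_idem, Function.update_self, bdist_def, bdist_def, inv_one, one_mul, one_mul,
    GaugeGroup.dist1_inv]

end Centre

/-! ## §2  The law side AT THE SAME EXTERIOR: odd part ∕ diagonal ∕ centre offset -/

section LawSide

variable {P : Params} {j : ℕ} {G : Type*} [GaugeGroup G] [MeasurableSpace G] [HaarData G]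
variable [DecidableEq (PBond P j)]

/-- **LAW AND READING SHARE THE EXTERIOR**: the conditional mean field of the adapted reading under the conditional law
of `w` through `u` is the mean of the one-bond increments AT `(u, c u)`:
`condMeanField s w (incrReadingAd s g c) u b = ∫ bondIncr s g u (c u) y b ∂condLaw s w u`. [folklore] -/
theorem condMeanField_incrReadingAd (s : Finset (PBond P j)) (g : Density P j G) {c : GaugeField P j G → s → G}
    (hc : CentreIndep s c) (w : Density P j G) (u : GaugeField P j G) (b : s) :
    condMeanField s w (incrReadingAd s g c) u b = ∫ y, bondIncr s g u (c u) y b ∂condLaw s w u := by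
  simp only [condMeanField, incrReadingAd_updateFinset s g hc]

omit [GaugeGroup G] [MeasurableSpace G] [HaarData G] in
/-- **RECENTRING IDENTITY**: the increment about the chart centre `y₀` equals the increment about the recentred point
`(y₀; b ← y₁ b)` plus the CENTRE OFFSET `bondIncr s g V y₀ y₁ b = g(V ← (y₀; b ← y₁ b)) − g(V ← y₀)` (a constant in the
fibre variable). [folklore] -/
theorem bondIncr_recenter (s : Finset (PBond P j)) (g : Density P j G) (V : GaugeField P j G) (y₀ y₁ y : s → G)
    (b : s) : bondIncr s g V y₀ y b = bondIncr s g V (Function.update y₀ b (y₁ b)) y b + bondIncr s g V y₀ y₁ b := by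
  simp only [bondIncr, Function.update_idem]
  ring

/-- **THE THREE-PIECE BOUND AT ONE EXTERIOR**: for a bounded measurable weight, a bounded law and ANY law centre `y₁`,
`|condMeanField s w (incrReadingAd s g c) u b| ≤ |∫ oddIncr(u, c″)| + |∫ evenIncr(u, c″)| + |bondIncr s g u (c u) y₁ b|`
with `c″ = (c u; b ← y₁ b)` — odd part about the law centre, even part (diagonal), centre offset (the conditional law is
zero or a probability measure, so the constant offset integrates to at most its size). [folklore] -/
theorem abs_condMeanField_incrReadingAd_le [RegularGaugeGroup G] (s : Finset (PBond P j)) {g : Density P j G}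
    (hg : Measurable g) {Bg : ℝ} (hBg : ∀ U, |g U| ≤ Bg) {c : GaugeField P j G → s → G} (hc : CentreIndep s c)
    {w : Density P j G} {C : ℝ} (hC : ∀ U, w U ≤ C) (u : GaugeField P j G) (y₁ : s → G) (b : s) :
    |condMeanField s w (incrReadingAd s g c) u b|
      ≤ |∫ y, oddIncr s g u (Function.update (c u) b (y₁ b)) y b ∂condLaw s w u|
        + |∫ y, evenIncr s g u (Function.update (c u) b (y₁ b)) y b ∂condLaw s w u|
        + |bondIncr s g u (c u) y₁ b| := by
  haveI := isZeroOrProbabilityMeasure_condLaw s hC u (old := w)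
  set c'' : s → G := Function.update (c u) b (y₁ b) with hc''
  have hKi : ∀ (y₀ y : s → G), |bondIncr s g u y₀ y b| ≤ Bg + Bg := fun y₀ y =>
    (abs_sub _ _).trans (add_le_add (hBg _) (hBg _))
  have hmo : Measurable fun y : s → G => oddIncr s g u c'' y b :=
    ((measurable_bondIncr s hg u c'' b).sub
      ((measurable_bondIncr s hg u c'' b).comp (measurable_bondReflect c'' b))).div_const 2
  have hme : Measurable fun y : s → G => evenIncr s g u c'' y b :=
    ((measurable_bondIncr s hg u c'' b).add
      ((measurable_bondIncr s hg u c'' b).comp (measurable_bondReflect c'' b))).div_const 2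
  have hio : Integrable (fun y => oddIncr s g u c'' y b) (condLaw s w u) :=
    integrable_condLaw_of_bounded s hC u hmo fun y =>
      (abs_oddIncr_le_of_abs_bondIncr_le s g u c'' y b (hKi _ _) (hKi _ _)).1
  have hie : Integrable (fun y => evenIncr s g u c'' y b) (condLaw s w u) :=
    integrable_condLaw_of_bounded s hC u hme fun y =>
      (abs_oddIncr_le_of_abs_bondIncr_le s g u c'' y b (hKi _ _) (hKi _ _)).2
  have hsplit : (fun y : s → G => bondIncr s g u (c u) y b)
      = fun y => (oddIncr s g u c'' y b + evenIncr s g u c'' y b) + bondIncr s g u (c u) y₁ b := by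
    funext y
    rw [oddIncr_add_evenIncr, hc'', ← bondIncr_recenter]
  have hK : |∫ _ : s → G, bondIncr s g u (c u) y₁ b ∂condLaw s w u| ≤ |bondIncr s g u (c u) y₁ b| := by
    rw [integral_const, smul_eq_mul, abs_mul, abs_of_nonneg measureReal_nonneg]
    exact mul_le_of_le_one_left (abs_nonneg _) measureReal_le_one
  have hioe : Integrable (fun y => oddIncr s g u c'' y b + evenIncr s g u c'' y b) (condLaw s w u) :=
    hio.add hie
  rw [condMeanField_incrReadingAd s g hc, hsplit, integral_add hioe (integrable_const _), integral_add hio hie]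
  exact (abs_add_le _ _).trans (add_le_add (abs_add_le _ _) hK)

/-- **THE ADAPTED READING'S SUPPRESSION DATUM FROM THE THREE FUNCTIONALS** `α` (odd-mean defect about the law centre
`c′ u`), `κ` (diagonal), `ω` (centre offset), on a domain `dom` of exteriors:
`CondMeanSuppression dom (condMeanField s w (incrReadingAd s g c)) univ (fun u => α u + κ u + ω u) 1` — the law-side
hypothesis `hsupᵢ` of `condMeanGap_of_separableAd` ∕ `condMeanGap_of_loopProdAd`.  NO exterior variation, NO flatness
uniform in the exterior. [folklore] -/
theorem condMeanSuppression_incrReadingAd_of_split [RegularGaugeGroup G] (s : Finset (PBond P j))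
    {g : Density P j G} (hg : Measurable g) {Bg : ℝ} (hBg : ∀ U, |g U| ≤ Bg) {c : GaugeField P j G → s → G}
    (hc : CentreIndep s c) {w : Density P j G} {C : ℝ} (hC : ∀ U, w U ≤ C) (c' : GaugeField P j G → s → G)
    {dom : Set (GaugeField P j G)} {α κ ω : GaugeField P j G → ℝ}
    (hodd : ∀ u ∈ dom, ∀ b : s,
      |∫ y, oddIncr s g u (Function.update (c u) b (c' u b)) y b ∂condLaw s w u| ≤ α u)
    (heven : ∀ u ∈ dom, ∀ b : s,
      |∫ y, evenIncr s g u (Function.update (c u) b (c' u b)) y b ∂condLaw s w u| ≤ κ u)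
    (hoff : ∀ u ∈ dom, ∀ b : s, |bondIncr s g u (c u) (c' u) b| ≤ ω u) :
    CondMeanSuppression dom (condMeanField s w (incrReadingAd s g c)) Finset.univ (fun u => α u + κ u + ω u) 1 := by
  intro u hu b _
  rw [one_mul, Real.norm_eq_abs]
  exact (abs_condMeanField_incrReadingAd_le s hg hBg hc hC u (c' u) b).trans
    (add_le_add (add_le_add (hodd u hu b) (heven u hu b)) (hoff u hu b))

/-- **THE ODD PART ABOUT THE LAW CENTRE HAS MEAN ZERO UNDER A LAW SYMMETRIC ABOUT THAT CENTRE** (whatever the chart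
centre): `(condLaw s w u).map (bondReflect y₁ b) = condLaw s w u` ⇒ `∫ oddIncr s g u (c u; b ← y₁ b) y b = 0` —
`T4SeparableFibreExpansion.integral_oddIncr_eq_zero` BY NAME through `bondReflect_update`. [folklore] -/
theorem integral_oddIncr_recenter_eq_zero [RegularGaugeGroup G] (s : Finset (PBond P j)) {g : Density P j G}
    (hg : Measurable g) {Bg : ℝ} (hBg : ∀ U, |g U| ≤ Bg) {w : Density P j G} {C : ℝ} (hC : ∀ U, w U ≤ C)
    (u : GaugeField P j G) (y₀ y₁ : s → G) (b : s) (hsym : (condLaw s w u).map (bondReflect y₁ b) = condLaw s w u) :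
    ∫ y, oddIncr s g u (Function.update y₀ b (y₁ b)) y b ∂condLaw s w u = 0 :=
  integral_oddIncr_eq_zero s g u (Function.update y₀ b (y₁ b)) b (by rw [bondReflect_update]; exact hsym)
    (integrable_condLaw_of_bounded s hC u (measurable_bondIncr s hg u _ b) fun y =>
      (abs_sub _ _).trans (add_le_add (hBg _) (hBg _)))

/-- **DATUM UNDER LAW SYMMETRY**: if on `dom` the conditional law of `w` at `u` is symmetric under every bond reflection
through the law centre `c′ u`, the odd functional drops: `CondMeanSuppression dom (condMeanField s w (incrReadingAd s g
c)) univ (fun u => κ u + ω u) 1`. [folklore] -/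
theorem condMeanSuppression_incrReadingAd_of_lawSymm [RegularGaugeGroup G] (s : Finset (PBond P j))
    {g : Density P j G} (hg : Measurable g) {Bg : ℝ} (hBg : ∀ U, |g U| ≤ Bg) {c : GaugeField P j G → s → G}
    (hc : CentreIndep s c) {w : Density P j G} {C : ℝ} (hC : ∀ U, w U ≤ C) (c' : GaugeField P j G → s → G)
    {dom : Set (GaugeField P j G)} {κ ω : GaugeField P j G → ℝ}
    (hsym : ∀ u ∈ dom, ∀ b : s, (condLaw s w u).map (bondReflect (c' u) b) = condLaw s w u)
    (heven : ∀ u ∈ dom, ∀ b : s,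
      |∫ y, evenIncr s g u (Function.update (c u) b (c' u b)) y b ∂condLaw s w u| ≤ κ u)
    (hoff : ∀ u ∈ dom, ∀ b : s, |bondIncr s g u (c u) (c' u) b| ≤ ω u) :
    CondMeanSuppression dom (condMeanField s w (incrReadingAd s g c)) Finset.univ (fun u => κ u + ω u) 1 := by
  have h := condMeanSuppression_incrReadingAd_of_split s hg hBg hc hC c' (α := fun _ => 0)
    (fun u hu b => by rw [integral_oddIncr_recenter_eq_zero s hg hBg hC u (c u) (c' u) b (hsym u hu b), abs_zero])
    heven hoff
  simpa only [zero_add] using h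

/-- **DATUM UNDER WEIGHT SYMMETRY**: the law symmetry discharged to the WEIGHT on the fibre through `u`
(`T4SeparableFibreExpansion.map_bondReflect_condLaw` BY NAME): `w (u ← bondReflect (c′ u) b y) = w (u ← y)` for all
`y`, `u ∈ dom`, `b` ⇒ datum `κ + ω`.  (For the WINDOW factor of a relative-window law about the background centre this
is §1's `relWindow_bondReflect`; products of symmetric factors are symmetric.) [folklore] -/
theorem condMeanSuppression_incrReadingAd_of_weightSymm [RegularGaugeGroup G] (s : Finset (PBond P j))
    {g : Density P j G} (hg : Measurable g) {Bg : ℝ} (hBg : ∀ U, |g U| ≤ Bg) {c : GaugeField P j G → s → G}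
    (hc : CentreIndep s c) {w : Density P j G} {C : ℝ} (hC : ∀ U, w U ≤ C) (c' : GaugeField P j G → s → G)
    {dom : Set (GaugeField P j G)} {κ ω : GaugeField P j G → ℝ}
    (hwsym : ∀ u ∈ dom, ∀ (b : s) (y : s → G),
      w (updateFinset u s (bondReflect (c' u) b y)) = w (updateFinset u s y))
    (heven : ∀ u ∈ dom, ∀ b : s,
      |∫ y, evenIncr s g u (Function.update (c u) b (c' u b)) y b ∂condLaw s w u| ≤ κ u)
    (hoff : ∀ u ∈ dom, ∀ b : s, |bondIncr s g u (c u) (c' u) b| ≤ ω u) :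
    CondMeanSuppression dom (condMeanField s w (incrReadingAd s g c)) Finset.univ (fun u => κ u + ω u) 1 :=
  condMeanSuppression_incrReadingAd_of_lawSymm s hg hBg hc hC c' (fun u hu b =>
    map_bondReflect_condLaw s w u (c' u) b (hwsym u hu b)) heven hoff

/-- **LAW CENTRE = CHART CENTRE**: the offset vanishes and the datum is the DIAGONAL alone —
`CondMeanSuppression dom (condMeanField s w (incrReadingAd s g c)) univ κ 1` under symmetry of `condLaw s w u` about
`c u`.  (The typed dissolution of record items (L-b)/(L-c): no exterior term, no uniform flatness; what is left is second
order given a one-bond second-difference modulus, `abs_integral_evenIncr_le_of_secondDiff`.) [folklore] -/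
theorem condMeanSuppression_incrReadingAd_of_lawSymm_self [RegularGaugeGroup G] (s : Finset (PBond P j))
    {g : Density P j G} (hg : Measurable g) {Bg : ℝ} (hBg : ∀ U, |g U| ≤ Bg) {c : GaugeField P j G → s → G}
    (hc : CentreIndep s c) {w : Density P j G} {C : ℝ} (hC : ∀ U, w U ≤ C) {dom : Set (GaugeField P j G)}
    {κ : GaugeField P j G → ℝ} (hsym : ∀ u ∈ dom, ∀ b : s, (condLaw s w u).map (bondReflect (c u) b) = condLaw s w u)
    (heven : ∀ u ∈ dom, ∀ b : s, |∫ y, evenIncr s g u (c u) y b ∂condLaw s w u| ≤ κ u) :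
    CondMeanSuppression dom (condMeanField s w (incrReadingAd s g c)) Finset.univ κ 1 := by
  have h := condMeanSuppression_incrReadingAd_of_lawSymm s hg hBg hc hC c (ω := fun _ => 0) hsym
    (fun u hu b => by rw [Function.update_eq_self]; exact heven u hu b)
    (fun u hu b => by simp [bondIncr])
  simpa only [add_zero] using h

/-- **THE DIAGONAL FROM AN A.E. MAJORANT**: `|evenIncr(u, y₀) y b| ≤ D y` for `condLaw s w u`-a.e. `y`, `D` integrable
⇒ `|∫ evenIncr| ≤ ∫ D` (e.g. `D y = κ₀·bdist(y₀ b, y b)²`: κ₀ × the law's one-bond second moment about the centre).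
[folklore] -/
theorem abs_integral_evenIncr_le (s : Finset (PBond P j)) (g : Density P j G) (u : GaugeField P j G) (y₀ : s → G)
    (w : Density P j G) (b : s) {D : (s → G) → ℝ} (hD : ∀ᵐ y ∂condLaw s w u, |evenIncr s g u y₀ y b| ≤ D y)
    (hDi : Integrable D (condLaw s w u)) :
    |∫ y, evenIncr s g u y₀ y b ∂condLaw s w u| ≤ ∫ y, D y ∂condLaw s w u := by
  have h := norm_integral_le_of_norm_le hDi (hD.mono fun y hy => by rw [Real.norm_eq_abs]; exact hy)
  rwa [Real.norm_eq_abs] at h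

/-- **THE DIAGONAL FROM THE ONE-BOND SECOND-DIFFERENCE SHAPE ON THE LAW'S SUPPORT** (`hdiag` at the reference `(u, y₀)`
at the fibre points where the weight `w` is non-zero — the consumer-side reading of a one-bond second-order modulus of
the weight `g`; for loop products §3 discharges it from t4-lean's `LoopDiagDerivBound` BY NAME):
`|∫ evenIncr| ≤ (∫ D)/2`. [folklore] -/
theorem abs_integral_evenIncr_le_of_secondDiff (s : Finset (PBond P j)) (g : Density P j G) (u : GaugeField P j G)
    (y₀ : s → G) {w : Density P j G} (hw : Measurable w) (b : s) {D : (s → G) → ℝ}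
    (hDi : Integrable D (condLaw s w u))
    (hdiag : ∀ y : s → G, w (updateFinset u s y) ≠ 0 →
      |g (updateFinset u s (Function.update y₀ b (y b))) - 2 * g (updateFinset u s y₀)
        + g (updateFinset u s (Function.update y₀ b (y₀ b * (y b)⁻¹ * y₀ b)))| ≤ D y) :
    |∫ y, evenIncr s g u y₀ y b ∂condLaw s w u| ≤ (∫ y, D y ∂condLaw s w u) / 2 := by
  have h := abs_integral_evenIncr_le s g u y₀ w b (D := fun y => D y / 2)
    (ae_condLaw_of_support s hw u fun y hy => abs_evenIncr_le_of_secondDiff s g u y₀ y b (hdiag y hy))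
    (hDi.div_const 2)
  rwa [integral_div] at h

omit [DecidableEq (PBond P j)] [HaarData G] in
/-- Measurability of the one-bond distance to a fixed group element along a fibre coordinate. [folklore] -/
theorem measurable_bdist_apply [RegularGaugeGroup G] {s : Finset (PBond P j)} (g₀ : G) (b : s) :
    Measurable fun y : s → G => bdist g₀ (y b) := by
  simp_rw [bdist_def]
  exact RegularGaugeGroup.measurable_dist1.comp (measurable_const.mul (measurable_pi_apply b))

/-- **ONE-BOND SECOND MOMENT FROM A WINDOW**: if the weight `w` vanishes at the fibre points over `u` whose `b`-th
variable is farther than `ε` from `y₀ b`, the conditional law's one-bond second moment about `y₀ b` is at most `ε²`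
(law zero or a probability measure). [folklore] -/
theorem secondMoment_le_of_window [RegularGaugeGroup G] (s : Finset (PBond P j)) {w : Density P j G}
    (hw : Measurable w) {C : ℝ} (hC : ∀ U, w U ≤ C) (u : GaugeField P j G) (y₀ : s → G) (b : s) {ε : ℝ}
    (hwin : ∀ y : s → G, w (updateFinset u s y) ≠ 0 → bdist (y₀ b) (y b) ≤ ε) :
    Integrable (fun y : s → G => bdist (y₀ b) (y b) ^ 2) (condLaw s w u) ∧
      ∫ y, bdist (y₀ b) (y b) ^ 2 ∂condLaw s w u ≤ ε ^ 2 := by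
  haveI := isZeroOrProbabilityMeasure_condLaw s hC u (old := w)
  have hmeas : Measurable fun y : s → G => bdist (y₀ b) (y b) ^ 2 := (measurable_bdist_apply (y₀ b) b).pow_const 2
  have hae : ∀ᵐ y ∂condLaw s w u, ‖bdist (y₀ b) (y b) ^ 2‖ ≤ ε ^ 2 :=
    ae_condLaw_of_support s hw u fun y hy => by
      rw [Real.norm_eq_abs, abs_of_nonneg (sq_nonneg _)]
      exact pow_le_pow_left₀ (bdist_nonneg _ _) (hwin y hy) 2
  have hint : Integrable (fun y : s → G => bdist (y₀ b) (y b) ^ 2) (condLaw s w u) :=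
    (integrable_const (ε ^ 2)).mono' hmeas.aestronglyMeasurable hae
  refine ⟨hint, (Real.le_norm_self _).trans ((norm_integral_le_of_norm_le (integrable_const _) hae).trans ?_)⟩
  rw [integral_const, smul_eq_mul]
  exact mul_le_of_le_one_left (sq_nonneg ε) measureReal_le_one

/-- A LIVE exterior carries a support point of the weight on its fibre (the conditional law there is a probability
measure and is carried by the support). [folklore] -/
theorem exists_ne_zero_of_mem_liveSet (s : Finset (PBond P j)) {w : Density P j G} (hw : Measurable w) {C : ℝ}
    (hC : ∀ U, w U ≤ C) {V : GaugeField P j G} (hV : V ∈ liveSet s w) :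
    ∃ y : s → G, w (updateFinset V s y) ≠ 0 := by
  by_contra h
  have h' : ∀ y : s → G, w (updateFinset V s y) = 0 := fun y => by_contra fun hy => h ⟨y, hy⟩
  haveI := isProbabilityMeasure_condLaw s hC V hV
  have hae : ∀ᵐ y ∂condLaw s w V, False := ae_condLaw_of_support s hw V fun y hy => hy (h' y)
  rw [Filter.eventually_false_iff_eq_bot, ae_eq_bot] at hae
  exact IsProbabilityMeasure.ne_zero (condLaw s w V) hae

omit [MeasurableSpace G] [HaarData G] [DecidableEq (PBond P j)] in
/-- Triangle inequality for the one-bond size (`dist1 (gh) ≤ dist1 g + dist1 h`). [folklore] -/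
theorem bdist_triangle (g h k : G) : bdist g k ≤ bdist g h + bdist h k := by
  have e : g⁻¹ * k = g⁻¹ * h * (h⁻¹ * k) := by group
  rw [bdist_def, bdist_def, bdist_def, e]
  exact GaugeGroup.dist1_mul_le _ _

end LawSide

/-! ## §3  Loop products: the one-bond increment rate, the centre offset, and the end-to-end corollary -/

section Loop

variable {P : Params} {j : ℕ} {G : Type*} [GaugeGroup G] [MeasurableSpace G] [HaarData G]
variable [DecidableEq (PBond P j)]

omit [DecidableEq (PBond P j)] [GaugeGroup G] [MeasurableSpace G] [HaarData G] in
/-- THE ONE-BOND INCREMENT RATE of a product of loop variables: `Σᵢ C₁|wᵢ|θ₁ⁿ`. [folklore] -/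
def loopIncrRate {σ : Type*} {d : ℕ} (C₁ θ₁ : ℝ) (n : ℕ) (ws : List (σ × List (Letter d))) : ℝ :=
  (ws.map fun xw => C₁ * (xw.2.length : ℝ) * θ₁ ^ n).sum

omit [DecidableEq (PBond P j)] [GaugeGroup G] [MeasurableSpace G] [HaarData G] in
/-- [folklore] -/
theorem loopIncrRate_nonneg {σ : Type*} {d : ℕ} {C₁ θ₁ : ℝ} (hC₁ : 0 ≤ C₁) (hθ₁ : 0 ≤ θ₁) (n : ℕ)
    (ws : List (σ × List (Letter d))) : 0 ≤ loopIncrRate C₁ θ₁ n ws := by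
  refine List.sum_nonneg ?_
  intro r hr
  rw [List.mem_map] at hr
  obtain ⟨xw, _, rfl⟩ := hr
  positivity

omit [DecidableEq (PBond P j)] [GaugeGroup G] [MeasurableSpace G] [HaarData G] in
/-- [folklore] -/
theorem loopIncrRate_cons {σ : Type*} {d : ℕ} (C₁ θ₁ : ℝ) (n : ℕ) (xw : σ × List (Letter d))
    (ws : List (σ × List (Letter d))) :
    loopIncrRate C₁ θ₁ n (xw :: ws) = C₁ * (xw.2.length : ℝ) * θ₁ ^ n + loopIncrRate C₁ θ₁ n ws := by
  simp only [loopIncrRate, List.map_cons, List.sum_cons]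

omit [HaarData G] in
/-- **THE SIZE OF A ONE-BOND INCREMENT OF `loopProdW`** from the first-difference shape `LoopDerivBound av dom C₁ θ₁`
ALONE (discrete Leibniz rule along the list, `|W| ≤ 1`): both configurations in `dom j` ⇒
`|bondIncr s (loopProdW av j n ws) V₀ y₀ y b| ≤ loopIncrRate C₁ θ₁ n ws · bdist (y₀ b) (y b)`. [folklore] -/
theorem abs_bondIncr_loopProdW_le [RegularGaugeGroup G] {av : ∀ i, Averaging P i G}
    {dom : ∀ i, Set (GaugeField P i G)} {C₁ θ₁ : ℝ} (hder : LoopDerivBound av dom C₁ θ₁) (hC₁ : 0 ≤ C₁)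
    (hθ₁ : 0 ≤ θ₁) {n : ℕ} (hn : j + n ≤ P.m + P.K) (s : Finset (PBond P j)) {V₀ : GaugeField P j G}
    {y₀ y : s → G} (b : s) (h₀ : updateFinset V₀ s y₀ ∈ dom j)
    (hb : updateFinset V₀ s (Function.update y₀ b (y b)) ∈ dom j) :
    ∀ (ws : List (Site P (j + n) × List (Letter P.d))), (∀ xw ∈ ws, walkEnd xw.1 xw.2 = xw.1) →
      |bondIncr s (loopProdW av j n ws) V₀ y₀ y b| ≤ loopIncrRate C₁ θ₁ n ws * bdist (y₀ b) (y b)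
  | [], _ => by simp [bondIncr, loopProdW, loopIncrRate]
  | xw :: ws, hws => by
    have ih := abs_bondIncr_loopProdW_le hder hC₁ hθ₁ hn s b h₀ hb ws
      (fun xw' h' => hws xw' (List.mem_cons_of_mem _ h'))
    have h1 := abs_bondIncr_loop_le hder hn (hws xw List.mem_cons_self) s b h₀ hb
    have hW : |loopAt (iterFrom av j n (updateFinset V₀ s y₀)) (walk xw.1 xw.2)| ≤ 1 := abs_loopAt_le_one _ _
    have hPi : |loopProdW av j n ws (updateFinset V₀ s (Function.update y₀ b (y b)))| ≤ 1 :=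
      abs_loopProdW_le_one av j n ws _
    have hsplit : bondIncr s (loopProdW av j n (xw :: ws)) V₀ y₀ y b
        = bondIncr s (fun U => loopAt (iterFrom av j n U) (walk xw.1 xw.2)) V₀ y₀ y b
            * loopProdW av j n ws (updateFinset V₀ s (Function.update y₀ b (y b)))
          + loopAt (iterFrom av j n (updateFinset V₀ s y₀)) (walk xw.1 xw.2)
            * bondIncr s (loopProdW av j n ws) V₀ y₀ y b := by
      simp only [bondIncr, loopProdW, List.map_cons, List.prod_cons]
      ring
    have hr₀ : 0 ≤ C₁ * (xw.2.length : ℝ) * θ₁ ^ n := by positivity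
    have hd : 0 ≤ bdist (y₀ b) (y b) := bdist_nonneg _ _
    rw [hsplit, loopIncrRate_cons, add_mul]
    refine (abs_add_le _ _).trans (add_le_add ?_ ?_)
    · rw [abs_mul]
      calc |bondIncr s (fun U => loopAt (iterFrom av j n U) (walk xw.1 xw.2)) V₀ y₀ y b|
            * |loopProdW av j n ws (updateFinset V₀ s (Function.update y₀ b (y b)))|
          ≤ (C₁ * (xw.2.length : ℝ) * bdist (y₀ b) (y b) * θ₁ ^ n) * 1 :=
            mul_le_mul h1 hPi (abs_nonneg _) (by positivity)
        _ = C₁ * (xw.2.length : ℝ) * θ₁ ^ n * bdist (y₀ b) (y b) := by ring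
    · rw [abs_mul]
      calc |loopAt (iterFrom av j n (updateFinset V₀ s y₀)) (walk xw.1 xw.2)|
            * |bondIncr s (loopProdW av j n ws) V₀ y₀ y b|
          ≤ 1 * (loopIncrRate C₁ θ₁ n ws * bdist (y₀ b) (y b)) :=
            mul_le_mul hW ih (abs_nonneg _) zero_le_one
        _ = loopIncrRate C₁ θ₁ n ws * bdist (y₀ b) (y b) := one_mul _

omit [HaarData G] in
/-- **THE CENTRE OFFSET OF `loopProdW`**: first order in the distance between the chart centre and the law centre at
the bond — `|bondIncr s (loopProdW …) u (c u) (c′ u) b| ≤ loopIncrRate · bdist (c u b) (c′ u b)` when `u ← c u` and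
`u ← (c u; b ← c′ u b)` lie in `dom j` (the binder `hoff` of §2; zero when the centres agree at `b`). [folklore] -/
theorem abs_centreOffset_loopProdW_le [RegularGaugeGroup G] {av : ∀ i, Averaging P i G}
    {dom : ∀ i, Set (GaugeField P i G)} {C₁ θ₁ : ℝ} (hder : LoopDerivBound av dom C₁ θ₁) (hC₁ : 0 ≤ C₁)
    (hθ₁ : 0 ≤ θ₁) {n : ℕ} (hn : j + n ≤ P.m + P.K)
    (ws : List (Site P (j + n) × List (Letter P.d))) (hws : ∀ xw ∈ ws, walkEnd xw.1 xw.2 = xw.1)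
    (s : Finset (PBond P j)) (c c' : GaugeField P j G → s → G) (u : GaugeField P j G) (b : s)
    (h₀ : updateFinset u s (c u) ∈ dom j) (hb : updateFinset u s (Function.update (c u) b (c' u b)) ∈ dom j) :
    |bondIncr s (loopProdW av j n ws) u (c u) (c' u) b| ≤ loopIncrRate C₁ θ₁ n ws * bdist (c u b) (c' u b) :=
  abs_bondIncr_loopProdW_le hder hC₁ hθ₁ hn s b h₀ hb ws hws

/-- **THE (CM) CHANNEL FOR `loopProdW`, END TO END, WITH EACH LAW SYMMETRIC ABOUT ITS OWN CENTRE.**  For one dressed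
term (`TermProvisos s ins old C`), the weight `loopProdW av j n ws` (closed walks, measurable averagings, regular gauge
group), the row's two averaging shapes on a fibre-convex domain, a chart centre `c₁` constant along fibres and
measurable, and
* LAW SIDE — on domains `dom₁, dom₂ ⊇ liveSet s old`: the OLD conditional law at `u` symmetric under every bond
  reflection through `c₁ u`, with diagonal functional `κ₁` (`|∫ evenIncr(u, c₁ u)| ≤ κ₁ u`); the INSERT law at `u`
  symmetric about ITS centre `c₂ u`, with diagonal `κ₂` (about `(c₁ u; b ← c₂ u b)`) and CENTRE-OFFSET functional `ω₂`
  (`|bondIncr(u, c₁ u)(c₂ u) b| ≤ ω₂ u`, e.g. `abs_centreOffset_loopProdW_le`); caps `κ₁ ≤ d₁`, `κ₂ + ω₂ ≤ d₂` on the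
  live set;
* COVER ∕ WINDOW — on the support of `old(V ← ·)` (resp. of `ins(V ← ·)` at old-live `V`): `V ← c₁ V` and `V ← y` in
  `dom j` and `(Σ_b bdist (c₁ V b) (y b))² ≤ Δ₁` (resp. `≤ Δ₂`);
the conclusion is `CondMeanGap s ins old (loopProdW av j n ws) ((|s|·d₁ + rate·Δ₁) + (|s|·d₂ + rate·Δ₂))`,
`rate = loopProdRate C₁ θ₁ C₂ θ₂ n ws`.  The insert's centre shift enters ONLY through `ω₂`; nothing about its size is
claimed. [folklore] -/
theorem condMeanGap_of_loopProdAd_symm [RegularGaugeGroup G] {s : Finset (PBond P j)} {ins old : Density P j G}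
    {C : ℝ} (hP : TermProvisos s ins old C) {av : ∀ i, Averaging P i G} (hav : ∀ i, Measurable (av i).avg)
    {dom : ∀ i, Set (GaugeField P i G)} {C₁ θ₁ C₂ θ₂ : ℝ} (hder : LoopDerivBound av dom C₁ θ₁)
    (hpair : LoopPairDerivBound av dom C₂ θ₂) (hconv : FibreConvex dom) (hC₁ : 0 ≤ C₁) (hθ₁ : 0 ≤ θ₁)
    (hC₂ : 0 ≤ C₂) (hθ₂ : 0 ≤ θ₂) {n : ℕ} (hn : j + n ≤ P.m + P.K)
    (ws : List (Site P (j + n) × List (Letter P.d))) (hws : ∀ xw ∈ ws, walkEnd xw.1 xw.2 = xw.1)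
    {c₁ : GaugeField P j G → s → G} (hc₁ : CentreIndep s c₁) (hc₁m : Measurable c₁) (c₂ : GaugeField P j G → s → G)
    {dom₁ dom₂ : Set (GaugeField P j G)} {κ₁ κ₂ ω₂ : GaugeField P j G → ℝ} {d₁ d₂ Δ₁ Δ₂ : ℝ}
    (hsym₁ : ∀ u ∈ dom₁, ∀ b : s, (condLaw s old u).map (bondReflect (c₁ u) b) = condLaw s old u)
    (heven₁ : ∀ u ∈ dom₁, ∀ b : s,
      |∫ y, evenIncr s (loopProdW av j n ws) u (c₁ u) y b ∂condLaw s old u| ≤ κ₁ u)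
    (hsym₂ : ∀ u ∈ dom₂, ∀ b : s, (condLaw s ins u).map (bondReflect (c₂ u) b) = condLaw s ins u)
    (heven₂ : ∀ u ∈ dom₂, ∀ b : s,
      |∫ y, evenIncr s (loopProdW av j n ws) u (Function.update (c₁ u) b (c₂ u b)) y b ∂condLaw s ins u| ≤ κ₂ u)
    (hoff₂ : ∀ u ∈ dom₂, ∀ b : s, |bondIncr s (loopProdW av j n ws) u (c₁ u) (c₂ u) b| ≤ ω₂ u)
    (hdom₁ : liveSet s old ⊆ dom₁) (hdom₂ : liveSet s old ⊆ dom₂) (hd₁ : ∀ V ∈ liveSet s old, κ₁ V ≤ d₁)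
    (hd₂ : ∀ V ∈ liveSet s old, κ₂ V + ω₂ V ≤ d₂)
    (hcov₁ : ∀ (V : GaugeField P j G) (y : s → G), old (updateFinset V s y) ≠ 0 →
      updateFinset V s (c₁ V) ∈ dom j ∧ updateFinset V s y ∈ dom j ∧ (∑ b : s, bdist (c₁ V b) (y b)) ^ 2 ≤ Δ₁)
    (hcov₂ : ∀ V ∈ liveSet s old, ∀ y : s → G, ins (updateFinset V s y) ≠ 0 →
      updateFinset V s (c₁ V) ∈ dom j ∧ updateFinset V s y ∈ dom j ∧ (∑ b : s, bdist (c₁ V b) (y b)) ^ 2 ≤ Δ₂) :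
    CondMeanGap s ins old (loopProdW av j n ws)
      (((s.card : ℝ) * d₁ + loopProdRate C₁ θ₁ C₂ θ₂ n ws * Δ₁)
        + ((s.card : ℝ) * d₂ + loopProdRate C₁ θ₁ C₂ θ₂ n ws * Δ₂)) := by
  have hg : Measurable (loopProdW av j n ws) := measurable_loopProdW av hav j n ws
  have hBg := abs_loopProdW_le_one av j n ws
  have hsup₁ := condMeanSuppression_incrReadingAd_of_lawSymm_self s hg hBg hc₁ hP.old_le hsym₁ heven₁
  have hsup₂ := condMeanSuppression_incrReadingAd_of_lawSymm s hg hBg hc₁ hP.ins_le c₂ hsym₂ heven₂ hoff₂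
  have h := condMeanGap_of_loopProdAd hP hav hder hpair hconv hC₁ hθ₁ hC₂ hθ₂ hn ws hws hc₁ hc₁m hsup₁ hsup₂
    hdom₁ hdom₂ hd₁ (fun V hV => hd₂ V hV) zero_le_one zero_le_one hcov₁ hcov₂
  simpa only [one_mul] using h

/-- **THE DIAGONAL OF `loopProdW` ABOUT ANY CENTRE, ON THE LAW'S SUPPORT, FROM `LoopDiagDerivBound` BY NAME**
(`T4AvgDiagBound.abs_evenIncr_loopProdW_le` at the reference `(u, y₀)`): if at every fibre point over `u` where the law's
weight `wt` is non-zero the three points `u ← y₀`, `u ← (y₀; b ← y b)`, `u ← (y₀; b ← y₀ b·(y b)⁻¹·y₀ b)` lie in `dom j`,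
and the conditional law at `u` has one-bond second moment about `y₀ b` at most `M`, then
`|∫ evenIncr s (loopProdW …) u y₀ y b ∂condLaw s wt u| ≤ (loopProdDiagRate C₁ θ₁ C₃ θ₃ n ws / 2)·M` — the diagonal
functional `κ` of §2, second order in the window radius (`secondMoment_le_of_window`). [folklore] -/
theorem abs_integral_evenIncr_loopProdW_le [RegularGaugeGroup G] {av : ∀ i, Averaging P i G}
    {dom : ∀ i, Set (GaugeField P i G)} {C₁ θ₁ C₃ θ₃ : ℝ} (hder : LoopDerivBound av dom C₁ θ₁)
    (hdiag : LoopDiagDerivBound av dom C₃ θ₃) (hC₃ : 0 ≤ C₃) (hθ₃ : 0 ≤ θ₃) {n : ℕ} (hn : j + n ≤ P.m + P.K)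
    (ws : List (Site P (j + n) × List (Letter P.d))) (hws : ∀ xw ∈ ws, walkEnd xw.1 xw.2 = xw.1)
    (s : Finset (PBond P j)) {wt : Density P j G} (hwt : Measurable wt) (u : GaugeField P j G) (y₀ : s → G) (b : s)
    (hfib : ∀ y : s → G, wt (updateFinset u s y) ≠ 0 →
      updateFinset u s y₀ ∈ dom j ∧ updateFinset u s (Function.update y₀ b (y b)) ∈ dom j ∧
        updateFinset u s (Function.update y₀ b (y₀ b * (y b)⁻¹ * y₀ b)) ∈ dom j)
    {M : ℝ} (hInt : Integrable (fun y : s → G => bdist (y₀ b) (y b) ^ 2) (condLaw s wt u))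
    (hM : ∫ y, bdist (y₀ b) (y b) ^ 2 ∂condLaw s wt u ≤ M) :
    |∫ y, evenIncr s (loopProdW av j n ws) u y₀ y b ∂condLaw s wt u|
      ≤ loopProdDiagRate C₁ θ₁ C₃ θ₃ n ws / 2 * M := by
  have hc : 0 ≤ loopProdDiagRate C₁ θ₁ C₃ θ₃ n ws / 2 :=
    div_nonneg (loopProdDiagRate_nonneg hC₃ hθ₃ n ws) zero_le_two
  have hD : ∀ᵐ y ∂condLaw s wt u, |evenIncr s (loopProdW av j n ws) u y₀ y b|
      ≤ loopProdDiagRate C₁ θ₁ C₃ θ₃ n ws / 2 * bdist (y₀ b) (y b) ^ 2 :=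
    ae_condLaw_of_support s hwt u fun y hy => by
      obtain ⟨h₀, hₚ, hₘ⟩ := hfib y hy
      exact (abs_evenIncr_loopProdW_le hder hdiag hn ws hws s b h₀ hₚ hₘ).trans_eq (by ring)
  refine (abs_integral_evenIncr_le s _ u y₀ wt b hD (hInt.const_mul _)).trans ?_
  rw [integral_const_mul]
  exact mul_le_mul_of_nonneg_left hM hc

/-- **THE (CM) CHANNEL FOR `loopProdW`, END TO END — LAW SIDE = SYMMETRY + ONE-BOND SECOND MOMENTS + CENTRE SHIFT.**
As `condMeanGap_of_loopProdAd_symm`, with the diagonal functionals DISCHARGED from t4-lean's `LoopDiagDerivBound av dom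
C₃ θ₃` BY NAME (`abs_integral_evenIncr_loopProdW_le`) and the offset from `LoopDerivBound`
(`abs_centreOffset_loopProdW_le`).  Remaining law-side binders, per live exterior `u` and fibre bond `b`: the OLD law
symmetric about `c₁ u` with window sections in `dom j` (`hfib₁`) and one-bond second moment `≤ M₁ u` about `c₁ u b`;
the INSERT law symmetric about `c₂ u` with sections in `dom j` (`hfib₂`) and second moment `≤ M₂ u` about ITS centre
`c₂ u b`; the centre points in `dom j` and the CENTRE SHIFT `bdist (c₁ u b) (c₂ u b) ≤ δ u` (`hoff₂`); caps `m₁, m₂,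
δ₀` on the live set; the window cover.  Conclusion:
`CondMeanGap … ((|s|·(r₃/2·m₁) + rate·Δ₁) + (|s|·(r₃/2·m₂ + r₁·δ₀) + rate·Δ₂))`, `r₃ = loopProdDiagRate C₁ θ₁ C₃ θ₃ n
ws`, `r₁ = loopIncrRate C₁ θ₁ n ws`, `rate = loopProdRate C₁ θ₁ C₂ θ₂ n ws` — the channel is SECOND ORDER in the
window data except for the single first-order term `|s|·r₁·δ₀`, the insert's centre shift. [folklore] -/
theorem condMeanGap_of_loopProdAd_moments [RegularGaugeGroup G] {s : Finset (PBond P j)} {ins old : Density P j G}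
    {C : ℝ} (hP : TermProvisos s ins old C) {av : ∀ i, Averaging P i G} (hav : ∀ i, Measurable (av i).avg)
    {dom : ∀ i, Set (GaugeField P i G)} {C₁ θ₁ C₂ θ₂ C₃ θ₃ : ℝ} (hder : LoopDerivBound av dom C₁ θ₁)
    (hpair : LoopPairDerivBound av dom C₂ θ₂) (hdiag : LoopDiagDerivBound av dom C₃ θ₃) (hconv : FibreConvex dom)
    (hC₁ : 0 ≤ C₁) (hθ₁ : 0 ≤ θ₁) (hC₂ : 0 ≤ C₂) (hθ₂ : 0 ≤ θ₂) (hC₃ : 0 ≤ C₃) (hθ₃ : 0 ≤ θ₃) {n : ℕ}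
    (hn : j + n ≤ P.m + P.K) (ws : List (Site P (j + n) × List (Letter P.d)))
    (hws : ∀ xw ∈ ws, walkEnd xw.1 xw.2 = xw.1) {c₁ : GaugeField P j G → s → G} (hc₁ : CentreIndep s c₁)
    (hc₁m : Measurable c₁) (c₂ : GaugeField P j G → s → G) {dom₁ dom₂ : Set (GaugeField P j G)}
    {M₁ M₂ δ : GaugeField P j G → ℝ} {m₁ m₂ δ₀ Δ₁ Δ₂ : ℝ}
    (hsym₁ : ∀ u ∈ dom₁, ∀ b : s, (condLaw s old u).map (bondReflect (c₁ u) b) = condLaw s old u)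
    (hfib₁ : ∀ u ∈ dom₁, ∀ (b : s) (y : s → G), old (updateFinset u s y) ≠ 0 →
      updateFinset u s (c₁ u) ∈ dom j ∧ updateFinset u s (Function.update (c₁ u) b (y b)) ∈ dom j ∧
        updateFinset u s (Function.update (c₁ u) b (c₁ u b * (y b)⁻¹ * c₁ u b)) ∈ dom j)
    (hM₁ : ∀ u ∈ dom₁, ∀ b : s, Integrable (fun y : s → G => bdist (c₁ u b) (y b) ^ 2) (condLaw s old u) ∧
      ∫ y, bdist (c₁ u b) (y b) ^ 2 ∂condLaw s old u ≤ M₁ u)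
    (hsym₂ : ∀ u ∈ dom₂, ∀ b : s, (condLaw s ins u).map (bondReflect (c₂ u) b) = condLaw s ins u)
    (hfib₂ : ∀ u ∈ dom₂, ∀ (b : s) (y : s → G), ins (updateFinset u s y) ≠ 0 →
      updateFinset u s (Function.update (c₁ u) b (c₂ u b)) ∈ dom j ∧
        updateFinset u s (Function.update (c₁ u) b (y b)) ∈ dom j ∧
          updateFinset u s (Function.update (c₁ u) b (c₂ u b * (y b)⁻¹ * c₂ u b)) ∈ dom j)
    (hM₂ : ∀ u ∈ dom₂, ∀ b : s, Integrable (fun y : s → G => bdist (c₂ u b) (y b) ^ 2) (condLaw s ins u) ∧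
      ∫ y, bdist (c₂ u b) (y b) ^ 2 ∂condLaw s ins u ≤ M₂ u)
    (hoff₂ : ∀ u ∈ dom₂, ∀ b : s, updateFinset u s (c₁ u) ∈ dom j ∧
      updateFinset u s (Function.update (c₁ u) b (c₂ u b)) ∈ dom j ∧ bdist (c₁ u b) (c₂ u b) ≤ δ u)
    (hdom₁ : liveSet s old ⊆ dom₁) (hdom₂ : liveSet s old ⊆ dom₂) (hm₁ : ∀ V ∈ liveSet s old, M₁ V ≤ m₁)
    (hm₂ : ∀ V ∈ liveSet s old, M₂ V ≤ m₂) (hδ₀ : ∀ V ∈ liveSet s old, δ V ≤ δ₀)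
    (hcov₁ : ∀ (V : GaugeField P j G) (y : s → G), old (updateFinset V s y) ≠ 0 →
      updateFinset V s (c₁ V) ∈ dom j ∧ updateFinset V s y ∈ dom j ∧ (∑ b : s, bdist (c₁ V b) (y b)) ^ 2 ≤ Δ₁)
    (hcov₂ : ∀ V ∈ liveSet s old, ∀ y : s → G, ins (updateFinset V s y) ≠ 0 →
      updateFinset V s (c₁ V) ∈ dom j ∧ updateFinset V s y ∈ dom j ∧ (∑ b : s, bdist (c₁ V b) (y b)) ^ 2 ≤ Δ₂) :
    CondMeanGap s ins old (loopProdW av j n ws)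
      (((s.card : ℝ) * (loopProdDiagRate C₁ θ₁ C₃ θ₃ n ws / 2 * m₁) + loopProdRate C₁ θ₁ C₂ θ₂ n ws * Δ₁)
        + ((s.card : ℝ) * (loopProdDiagRate C₁ θ₁ C₃ θ₃ n ws / 2 * m₂ + loopIncrRate C₁ θ₁ n ws * δ₀)
          + loopProdRate C₁ θ₁ C₂ θ₂ n ws * Δ₂)) := by
  have hr₃ : 0 ≤ loopProdDiagRate C₁ θ₁ C₃ θ₃ n ws / 2 :=
    div_nonneg (loopProdDiagRate_nonneg hC₃ hθ₃ n ws) zero_le_two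
  have hr₁ : 0 ≤ loopIncrRate C₁ θ₁ n ws := loopIncrRate_nonneg hC₁ hθ₁ n ws
  have heven₁ : ∀ u ∈ dom₁, ∀ b : s,
      |∫ y, evenIncr s (loopProdW av j n ws) u (c₁ u) y b ∂condLaw s old u|
        ≤ loopProdDiagRate C₁ θ₁ C₃ θ₃ n ws / 2 * M₁ u := fun u hu b =>
    abs_integral_evenIncr_loopProdW_le hder hdiag hC₃ hθ₃ hn ws hws s hP.old_meas u (c₁ u) b (hfib₁ u hu b)
      (hM₁ u hu b).1 (hM₁ u hu b).2
  have heven₂ : ∀ u ∈ dom₂, ∀ b : s,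
      |∫ y, evenIncr s (loopProdW av j n ws) u (Function.update (c₁ u) b (c₂ u b)) y b ∂condLaw s ins u|
        ≤ loopProdDiagRate C₁ θ₁ C₃ θ₃ n ws / 2 * M₂ u := by
    intro u hu b
    have e1 : ∀ x : G, Function.update (Function.update (c₁ u) b (c₂ u b)) b x = Function.update (c₁ u) b x :=
      fun x => Function.update_idem _ _ _
    have e2 : Function.update (c₁ u) b (c₂ u b) b = c₂ u b := Function.update_self _ _ _
    refine abs_integral_evenIncr_loopProdW_le hder hdiag hC₃ hθ₃ hn ws hws s hP.ins_meas u _ b ?_ ?_ ?_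
    · intro y hy
      rw [e1, e2, e1]
      exact hfib₂ u hu b y hy
    · simpa only [e2] using (hM₂ u hu b).1
    · simpa only [e2] using (hM₂ u hu b).2
  have hoff₂' : ∀ u ∈ dom₂, ∀ b : s,
      |bondIncr s (loopProdW av j n ws) u (c₁ u) (c₂ u) b| ≤ loopIncrRate C₁ θ₁ n ws * δ u := fun u hu b =>
    (abs_centreOffset_loopProdW_le hder hC₁ hθ₁ hn ws hws s c₁ c₂ u b (hoff₂ u hu b).1 (hoff₂ u hu b).2.1).trans
      (mul_le_mul_of_nonneg_left (hoff₂ u hu b).2.2 hr₁)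
  exact condMeanGap_of_loopProdAd_symm hP hav hder hpair hconv hC₁ hθ₁ hC₂ hθ₂ hn ws hws hc₁ hc₁m c₂ hsym₁ heven₁
    hsym₂ heven₂ hoff₂' hdom₁ hdom₂ (fun V hV => mul_le_mul_of_nonneg_left (hm₁ V hV) hr₃)
    (fun V hV => add_le_add (mul_le_mul_of_nonneg_left (hm₂ V hV) hr₃) (mul_le_mul_of_nonneg_left (hδ₀ V hV) hr₁))
    hcov₁ hcov₂

/-- **THE (CM) CHANNEL FOR `loopProdW`, END TO END, IN WINDOW DATA.**  The law side of `condMeanGap_of_loopProdAd_moments`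
discharged to WINDOWS about the centres: the old weight is supported, on every fibre, in the box of one-bond radius `ε₁`
about `c₁ V` (`hwin₁`), the insert in the box of radius `ε₂` about `c₂ V` (`hwin₂`), the centre shift is at most `δ₀` on
the old term's live set (`hshift`), the `ε₁`-box about `c₁ V` lies in `dom j` whenever the fibre through `V` meets the old
weight's support (`hbox₁`) and the `(δ₀ + ε₂)`-box about `c₁ V` lies in `dom j` at old-live `V` (`hbox₂`), and each
conditional law is symmetric about its own centre at the old-live exteriors.  Then
`CondMeanGap s ins old (loopProdW …) ((|s|·(r₃/2)·ε₁² + rate·(|s|ε₁)²) + (|s|·((r₃/2)·ε₂² + r₁·δ₀) + rate·(|s|(δ₀+ε₂))²))`.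
Every law-side hypothesis is now a support ∕ symmetry ∕ domain statement; the ONLY first-order quantity is the centre
shift `δ₀` (record item (L-h), NOT estimated here). [folklore] -/
theorem condMeanGap_of_loopProdAd_windows [RegularGaugeGroup G] {s : Finset (PBond P j)} {ins old : Density P j G}
    {C : ℝ} (hP : TermProvisos s ins old C) {av : ∀ i, Averaging P i G} (hav : ∀ i, Measurable (av i).avg)
    {dom : ∀ i, Set (GaugeField P i G)} {C₁ θ₁ C₂ θ₂ C₃ θ₃ : ℝ} (hder : LoopDerivBound av dom C₁ θ₁)
    (hpair : LoopPairDerivBound av dom C₂ θ₂) (hdiag : LoopDiagDerivBound av dom C₃ θ₃) (hconv : FibreConvex dom)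
    (hC₁ : 0 ≤ C₁) (hθ₁ : 0 ≤ θ₁) (hC₂ : 0 ≤ C₂) (hθ₂ : 0 ≤ θ₂) (hC₃ : 0 ≤ C₃) (hθ₃ : 0 ≤ θ₃) {n : ℕ}
    (hn : j + n ≤ P.m + P.K) (ws : List (Site P (j + n) × List (Letter P.d)))
    (hws : ∀ xw ∈ ws, walkEnd xw.1 xw.2 = xw.1) {c₁ : GaugeField P j G → s → G} (hc₁ : CentreIndep s c₁)
    (hc₁m : Measurable c₁) (c₂ : GaugeField P j G → s → G) {ε₁ ε₂ δ₀ : ℝ} (hε₂ : 0 ≤ ε₂) (hδ : 0 ≤ δ₀)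
    (hsym₁ : ∀ u ∈ liveSet s old, ∀ b : s, (condLaw s old u).map (bondReflect (c₁ u) b) = condLaw s old u)
    (hsym₂ : ∀ u ∈ liveSet s old, ∀ b : s, (condLaw s ins u).map (bondReflect (c₂ u) b) = condLaw s ins u)
    (hwin₁ : ∀ (V : GaugeField P j G) (b : s) (y : s → G), old (updateFinset V s y) ≠ 0 → bdist (c₁ V b) (y b) ≤ ε₁)
    (hwin₂ : ∀ (V : GaugeField P j G) (b : s) (y : s → G), ins (updateFinset V s y) ≠ 0 → bdist (c₂ V b) (y b) ≤ ε₂)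
    (hshift : ∀ V ∈ liveSet s old, ∀ b : s, bdist (c₁ V b) (c₂ V b) ≤ δ₀)
    (hbox₁ : ∀ V : GaugeField P j G, (∃ y : s → G, old (updateFinset V s y) ≠ 0) →
      ∀ y' : s → G, (∀ b : s, bdist (c₁ V b) (y' b) ≤ ε₁) → updateFinset V s y' ∈ dom j)
    (hbox₂ : ∀ V ∈ liveSet s old,
      ∀ y' : s → G, (∀ b : s, bdist (c₁ V b) (y' b) ≤ δ₀ + ε₂) → updateFinset V s y' ∈ dom j) :
    CondMeanGap s ins old (loopProdW av j n ws)
      (((s.card : ℝ) * (loopProdDiagRate C₁ θ₁ C₃ θ₃ n ws / 2 * ε₁ ^ 2)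
          + loopProdRate C₁ θ₁ C₂ θ₂ n ws * ((s.card : ℝ) * ε₁) ^ 2)
        + ((s.card : ℝ) * (loopProdDiagRate C₁ θ₁ C₃ θ₃ n ws / 2 * ε₂ ^ 2 + loopIncrRate C₁ θ₁ n ws * δ₀)
          + loopProdRate C₁ θ₁ C₂ θ₂ n ws * ((s.card : ℝ) * (δ₀ + ε₂)) ^ 2)) := by
  -- the window radius is non-negative as soon as some fibre meets the old weight's support
  have hε₁V : ∀ (V : GaugeField P j G) (y : s → G), old (updateFinset V s y) ≠ 0 → ∀ b : s, 0 ≤ ε₁ :=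
    fun V y hy b => (bdist_nonneg _ _).trans (hwin₁ V b y hy)
  -- box memberships used below
  have hcen₁ : ∀ (V : GaugeField P j G) (y : s → G), old (updateFinset V s y) ≠ 0 →
      updateFinset V s (c₁ V) ∈ dom j := fun V y hy =>
    hbox₁ V ⟨y, hy⟩ _ fun b => by rw [bdist_self]; exact hε₁V V y hy b
  have hupd₁ : ∀ (V : GaugeField P j G) (b : s) (y : s → G), old (updateFinset V s y) ≠ 0 → ∀ x : G,
      bdist (c₁ V b) x ≤ ε₁ → updateFinset V s (Function.update (c₁ V) b x) ∈ dom j := by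
    intro V b y hy x hx
    refine hbox₁ V ⟨y, hy⟩ _ fun b' => ?_
    by_cases hb' : b' = b
    · subst hb'; rwa [Function.update_self]
    · rw [Function.update_of_ne hb', bdist_self]; exact hε₁V V y hy b'
  have hupd₂ : ∀ V ∈ liveSet s old, ∀ (b : s) (x : G), bdist (c₁ V b) x ≤ δ₀ + ε₂ →
      updateFinset V s (Function.update (c₁ V) b x) ∈ dom j := by
    intro V hV b x hx
    refine hbox₂ V hV _ fun b' => ?_
    by_cases hb' : b' = b
    · subst hb'; rwa [Function.update_self]
    · rw [Function.update_of_ne hb', bdist_self]; positivity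
  have hcen₂ : ∀ V ∈ liveSet s old, updateFinset V s (c₁ V) ∈ dom j := fun V hV =>
    hbox₂ V hV _ fun b => by rw [bdist_self]; positivity
  -- the sum of the one-bond radii over the fibre
  have hsum : ∀ (V : GaugeField P j G) (y : s → G) (r : ℝ), (∀ b : s, bdist (c₁ V b) (y b) ≤ r) →
      (∑ b : s, bdist (c₁ V b) (y b)) ^ 2 ≤ ((s.card : ℝ) * r) ^ 2 := by
    intro V y r hr
    have h0 : 0 ≤ ∑ b : s, bdist (c₁ V b) (y b) := Finset.sum_nonneg fun b _ => bdist_nonneg _ _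
    have h1 : ∑ b : s, bdist (c₁ V b) (y b) ≤ (s.card : ℝ) * r := by
      calc ∑ b : s, bdist (c₁ V b) (y b) ≤ ∑ _b : s, r := Finset.sum_le_sum fun b _ => hr b
        _ = (s.card : ℝ) * r := by simp [Finset.sum_const]
    exact pow_le_pow_left₀ h0 h1 2
  refine condMeanGap_of_loopProdAd_moments hP hav hder hpair hdiag hconv hC₁ hθ₁ hC₂ hθ₂ hC₃ hθ₃ hn ws hws hc₁
    hc₁m c₂ (dom₁ := liveSet s old) (dom₂ := liveSet s old) (M₁ := fun _ => ε₁ ^ 2) (M₂ := fun _ => ε₂ ^ 2)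
    (δ := fun _ => δ₀) hsym₁ ?_ ?_ hsym₂ ?_ ?_ ?_ subset_rfl subset_rfl (fun _ _ => le_rfl) (fun _ _ => le_rfl)
    (fun _ _ => le_rfl) ?_ ?_
  · -- hfib₁ : sections of the old window about c₁ u
    intro u _ b y hy
    refine ⟨hcen₁ u y hy, hupd₁ u b y hy _ (hwin₁ u b y hy), hupd₁ u b y hy _ ?_⟩
    rw [bdist_reflect]; exact hwin₁ u b y hy
  · -- hM₁ : second moment of the old law about c₁ u b
    intro u _ b
    exact secondMoment_le_of_window s hP.old_meas hP.old_le u (c₁ u) b fun y hy => hwin₁ u b y hy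
  · -- hfib₂ : sections of the insert window, inside the (δ₀ + ε₂)-box about c₁ u
    intro u hu b y hy
    refine ⟨hupd₂ u hu b _ ((hshift u hu b).trans (le_add_of_nonneg_right hε₂)), hupd₂ u hu b _ ?_,
      hupd₂ u hu b _ ?_⟩
    · exact (bdist_triangle _ (c₂ u b) _).trans (add_le_add (hshift u hu b) (hwin₂ u b y hy))
    · refine (bdist_triangle _ (c₂ u b) _).trans (add_le_add (hshift u hu b) ?_)
      rw [bdist_reflect]; exact hwin₂ u b y hy
  · -- hM₂ : second moment of the insert law about its own centre
    intro u _ b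
    exact secondMoment_le_of_window s hP.ins_meas hP.ins_le u (c₂ u) b fun y hy => hwin₂ u b y hy
  · -- hoff₂ : centre points in dom and the shift
    intro u hu b
    exact ⟨hcen₂ u hu, hupd₂ u hu b _ ((hshift u hu b).trans (le_add_of_nonneg_right hε₂)), hshift u hu b⟩
  · -- hcov₁ : the old window cover
    intro V y hy
    exact ⟨hcen₁ V y hy, hbox₁ V ⟨y, hy⟩ y fun b => hwin₁ V b y hy, hsum V y ε₁ fun b => hwin₁ V b y hy⟩
  · -- hcov₂ : the insert window cover at old-live exteriors, about the OLD centre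
    intro V hV y hy
    have hr : ∀ b : s, bdist (c₁ V b) (y b) ≤ δ₀ + ε₂ := fun b =>
      (bdist_triangle _ (c₂ V b) _).trans (add_le_add (hshift V hV b) (hwin₂ V b y hy))
    exact ⟨hcen₂ V hV, hbox₂ V hV y hr, hsum V y _ hr⟩

end Loop

end Literature.MathematicalPhysics.QuantumFieldTheory.Balaban1983to89.T4AdaptedReference
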